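import Mathlib
import Summits.Ventures.HodgeRepro2.T5PadicFiniteOrderCharacters

/-!
# T5PadicTorsionCharactersCount — `#Ξ_𝔭[p^k] ≤ p^k`, with equality when `R ∋ μ_{p^k}`:
the numerical form of «Ξ_𝔭 ≃ μ_{p^∞}»

Cell pub-hodge-repro2, Tier 5 support (seat p7; route/T5-CHECK-G-p7.md §3 S5 / S8). T5PadicFiniteOrderCharacters
identifies the continuous characters of `Γ_𝔭 ≅ ℤ_p` of order dividing `p^k` with the `p^k`-th roots of unity of the
value ring, by `ν ↦ ν(γ₀)`. Counted, for `R` a domain: at most `p^k` such characters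
(`ncard_torsionChar_le`; `Polynomial.card_nthRoots`), and exactly `p^k` as soon as `R` contains a primitive `p^k`-th
root of unity (`ncard_torsionChar_eq`; `IsPrimitiveRoot.card_nthRoots_one`) — the layer `Ξ_𝔭[p^k]` of S5 / S8 has
`p^k` elements over `W[μ_{p^k}]`. Mathlib + T5PadicFiniteOrderCharacters only.
-/

namespace Summit.Ventures.HodgeRepro2.T5PadicTorsionCharactersCount

open PadicInt Filter Topology
open Summit.Ventures.HodgeRepro2.T5PadicFiniteOrderCharacters
open scoped Classical

variable {p : ℕ} [hp : Fact p.Prime]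
variable {R : Type*} [CommRing R] [IsDomain R] [TopologicalSpace R] [T2Space R]

/-- `Ξ_𝔭[p^k]`: the continuous characters `κ` of `ℤ_p` with `κ^{p^k} = 1`. -/
def torsionChar (k : ℕ) : Set {κ : AddChar ℤ_[p] R // Continuous κ} :=
  {κ | ∀ x : ℤ_[p], κ.1 x ^ (p ^ k) = 1}

omit [IsDomain R] [T2Space R] in
/-- Membership in `Ξ_𝔭[p^k]`. -/
@[simp] theorem mem_torsionChar (k : ℕ) (κ : {κ : AddChar ℤ_[p] R // Continuous κ}) :
    κ ∈ torsionChar k ↔ ∀ x : ℤ_[p], κ.1 x ^ (p ^ k) = 1 := Iff.rfl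

omit [T2Space R] in
/-- `ν ↦ ν(1)` maps `Ξ_𝔭[p^k]` into the `p^k`-th roots of unity. -/
theorem eval_one_mem_nthRoots (k : ℕ) {κ : {κ : AddChar ℤ_[p] R // Continuous κ}}
    (hκ : κ ∈ torsionChar k) :
    κ.1 1 ∈ (Polynomial.nthRoots (p ^ k) (1 : R)).toFinset := by
  rw [Multiset.mem_toFinset, Polynomial.mem_nthRoots (pow_pos hp.out.pos k)]
  exact hκ 1

omit [T2Space R] in
/-- `ν ↦ ν(1)` maps `Ξ_𝔭[p^k]` ONTO the `p^k`-th roots of unity (`ofRootOfUnity`). -/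
theorem image_eval_one_torsionChar (k : ℕ) :
    (fun κ : {κ : AddChar ℤ_[p] R // Continuous κ} => κ.1 1) '' torsionChar k =
      (↑(Polynomial.nthRoots (p ^ k) (1 : R)).toFinset : Set R) := by
  ext ζ
  constructor
  · rintro ⟨κ, hκ, rfl⟩
    exact eval_one_mem_nthRoots k hκ
  · intro hζ
    rw [Finset.mem_coe, Multiset.mem_toFinset, Polynomial.mem_nthRoots (pow_pos hp.out.pos k)] at hζ
    refine ⟨⟨ofRootOfUnity ζ k hζ, continuous_ofRootOfUnity ζ k hζ⟩, ?_, ofRootOfUnity_apply_one ζ k hζ⟩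
    exact ofRootOfUnity_pow ζ k hζ

/-- `ν ↦ ν(1)` is a bijection from `Ξ_𝔭[p^k]` onto the `p^k`-th roots of unity of `R`. -/
theorem bijOn_eval_one_torsionChar (k : ℕ) :
    Set.BijOn (fun κ : {κ : AddChar ℤ_[p] R // Continuous κ} => κ.1 1) (torsionChar k)
      (↑(Polynomial.nthRoots (p ^ k) (1 : R)).toFinset : Set R) := by
  refine ⟨fun κ hκ => eval_one_mem_nthRoots k hκ, eval_one_injective.injOn, ?_⟩
  rw [← image_eval_one_torsionChar k]
  exact Set.Subset.rfl

/-- `#Ξ_𝔭[p^k] = #{ζ ∈ R : ζ^{p^k} = 1}`. -/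
theorem ncard_torsionChar_eq_card_nthRoots (k : ℕ) :
    (torsionChar (p := p) (R := R) k).ncard = (Polynomial.nthRoots (p ^ k) (1 : R)).toFinset.card := by
  rw [(bijOn_eval_one_torsionChar k).ncard_eq, Set.ncard_coe_finset]

/-- `#Ξ_𝔭[p^k] ≤ p^k` for every domain `R` (a polynomial of degree `p^k` has at most `p^k` roots). -/
theorem ncard_torsionChar_le (k : ℕ) : (torsionChar (p := p) (R := R) k).ncard ≤ p ^ k := by
  rw [ncard_torsionChar_eq_card_nthRoots]
  exact (Multiset.toFinset_card_le _).trans (Polynomial.card_nthRoots _ _)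

/-- `#Ξ_𝔭[p^k] = p^k` when `R` contains a primitive `p^k`-th root of unity: S5's «Ξ_𝔭 ≃ μ_{p^∞}» counted
layer by layer over `W[μ_{p^k}]`. -/
theorem ncard_torsionChar_eq {ζ : R} (k : ℕ) (hζ : IsPrimitiveRoot ζ (p ^ k)) :
    (torsionChar (p := p) (R := R) k).ncard = p ^ k := by
  rw [ncard_torsionChar_eq_card_nthRoots, Multiset.toFinset_card_of_nodup hζ.nthRoots_one_nodup,
    hζ.card_nthRoots_one]

/-- `Ξ_𝔭[p^k]` is finite. -/
theorem finite_torsionChar (k : ℕ) : (torsionChar (p := p) (R := R) k).Finite :=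
  Set.finite_of_ncard_pos (by
    rw [ncard_torsionChar_eq_card_nthRoots]
    exact Nat.pos_of_ne_zero fun h => by
      have : (1 : R) ∈ (Polynomial.nthRoots (p ^ k) (1 : R)).toFinset := by
        rw [Multiset.mem_toFinset, Polynomial.mem_nthRoots (pow_pos hp.out.pos k), one_pow]
      rw [Finset.card_eq_zero] at h
      simp [h] at this)

end Summit.Ventures.HodgeRepro2.T5PadicTorsionCharactersCount
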